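import Summits.QuantumFields.YangMills.Theorems.BalabanLadderIRColdPurityBridgeRungs
import Summits.QuantumFields.YangMills.Theorems.BalabanLadderIRDefectSquaringSharp
import Literature.MathematicalPhysics.QuantumFieldTheory.WilsonFinTorusPartitionComplex
import Summits.QuantumFields.YangMills.Theorems.BalabanLadderIRColdDefectContinuous
import Summits.QuantumFields.YangMills.Theorems.BalabanLadderIRCouplingAxisTransport
import Summits.QuantumFields.YangMills.Theorems.BalabanLadderIRAbstractBasinRung24
import HarnessLib

/-!
# Crux `IR` (stmt-QuantumFields-19354) — line `coupling-clopen` (ideator ym-ir-idea-12 g0, lens «wuc»)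

SKELETON (rev 8: K1 re-based on tolerance 1/24 through idea-9's LANDED group-free ladder `AbstractBasin (1/24) 2⁻²⁴` (p604479 ∘ p603750 ∘ p603051;
rev 7 sat at 2⁻⁶), the transport `exitsUnboundedSC_of_basin` PARAMETRIC in the abstract rung; final composition BY NAME through `BasinRung.IR_of_exitAt`).  Target BY NAME: `Summit.QuantumFields.YangMills.Theses.BalabanLadder.IR`.

HONESTY.  Nothing here proves the Yang–Mills mass gap (Clay), the crux `IR`, or the seed `E`; R4 closes only the
conditional finite-𝕋⁴ rung `BalabanLadder.UV`.  This file is a CONDITIONAL REDUCTION: four registered stubs (rev 3: S `DefectContinuous` is now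
PROVED; rev 4: the CONVERSE `exitScaleTame_of_allExit` is PROVED, so `allExit_iff : AllExitSC ↔ K1 ∧ K2` is a kernel fact; `defectContinuous_holds`, from the entire complex partition function; `stub_exitsUnbounded` K1, `stub_exitScaleTame` K2, and BY NAME the tokens of record
`stub_afPin : AFToColdPressure` (X) and `stub_irnsc : IRnsc` (N)), everything else kernel-checked: the composition
`IR_of` is sorry-free and runs through the PROVED aspect bootstrap (`AspectBootstrap.coldDefect_sq_le_two_pow`, rev 2: sharp constant `2²⁰`,
i.e. `R` with the explicit SHARP constant `2²⁰` (`AspectBootstrap.coldDefect_sq_le_two_pow`), `L₀ = 8`, `β₀ = 0`), the PROVED seam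
`ColdPurityBridge.coldPressureAt_of_exit_recursion` and the PROVED pincer `ColdPressurePincer.IR_of_cp_repaired`.

THE LENS («weakest unknown consequence», «assume no gap» structure) applied to the seed `E = ColdExitSC` of the
census cut `IR ⇐ E ∧ R ∧ X ∧ N` (R proved 02:20Z).  With R a theorem and its threshold EXPLICIT, «coupling β EXITS»
(`Exits ρ β`: some cold `L³ × ⌊L/4⌋` torus, `L ≥ 8`, has purity defect `≤ exitTol = 1/(16·max(2²⁰,2)) = 2⁻²⁴`) is a
per-coupling predicate, and `E` (given R) says: every large coupling exits.  Two facts organise the coupling axis: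
* the set of exiting couplings is OPEN (R-decay to `exitTol/2` at one scale + continuity of `β ↦ δᶜ_β(L)`), and it
  contains the whole strong-coupling window `[0, r_ρ]` (PROVED rung `exits_strongCoupling`);
* a half-line `(β₁, ∞)` is CONNECTED.
Hence `E` splits EXACTLY (⇔, given R) into the two weakest statements this line files:
* (K1) `ExitsUnboundedSC` — exiting couplings are UNBOUNDED: for every `β₁` SOME `β ≥ β₁` exits.  This is `E` along an
  arbitrary SUBSEQUENCE of couplings: per instance ONE `(β, L)` with `δᶜ_β(L) ≤ exitTol` — a single strict inequality
  between two finite-dimensional Haar integrals (Σ₁: certifiable by computation if true; no uniformity, no units, no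
  «for all large β»).  It carries the Yang–Mills content (massiveness at SOME arbitrarily weak couplings) in the weakest
  quantifier shape the tree can still use.  FALSE for `U(1)₄` (Coulomb phase: no coupling `β > β_c` exits) and for
  `π₁(G) ≠ 1` (light flux vacua) — any proof uses non-abelianness and `π₁ = 1`.
* (K2) `ExitScaleTameSC` — beyond some `β₁`, on every compact coupling range `[u, v] ⊂ (β₁, ∞)` the exiting couplings
  are `exitTol/2`-pure at ONE COMMON SCALE `P`.  Equivalently (given R): the purity length `L_exit(β)` is locally bounded
  where finite; equivalently: NO FINITE COUPLING `β* > β₁` IS APPROACHED BY MASSIVE COUPLINGS WITH DIVERGING PURITY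
  LENGTH — no bulk phase transition (continuous, or first-order with its `V ∼ 1/Δf` rounding length) beyond `β₁`.  A
  STRUCTURAL, finite-coupling, group-blind-plausible statement: TRUE for `U(1)₄` (take `β₁ = β_c`: nothing exits beyond)
  and for every lattice gauge theory with finitely many bulk transitions; its only enemy is an infinite sequence of
  bulk transitions accumulating at `β = ∞`.
«Assume no gap»: if `E` fails for a simply-connected simple `G`, then by the clopen argument EITHER pure cold tori stop
existing beyond some coupling altogether (¬K1: a genuine massless/deconfined PHASE `[β_c, ∞)`), OR bulk transitions
accumulate at infinite coupling (¬K2).  There is no third way — isolated bad couplings cannot stop the propagation.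

COMPOSITION (proved here, `exits_of_clopen`): fix `β > β₁`; K1 gives an exiting `b₀ ≥ β + 1`; K2 on `[β, b₀]` gives a
common scale `P`; with `s = {b | δᶜ_b(P) ≤ exitTol/2}` (closed) and `o = {b | δᶜ_b(P) < exitTol}` (open) one has on
`[β, b₀]`: exits ⇒ `∈ s` ⇒ `∈ o` ⇒ exits; `isPreconnected_Icc` with the closed cover `s ∪ oᶜ` forces `β ∈ o`.  Then
(`onsetSC_of_exits`) each exit plus the explicit recursion gives `ColdPressureAt r.ρ β L` by the tree seam, i.e.
`ColdPressureOnsetSC`; the tree pincer `IR_of_cp_repaired` with X and N concludes `IR` BY NAME.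

WHY NOVEL (vs the 15+ lines of record and 40 census rows): no line or row propagates massiveness ALONG THE COUPLING AXIS
by connectedness; line 2 (`beta-slope-floor`) differentiates correlators in β (slope FLOOR, XL), af-pincer pins by AF,
lines 10/13 assert the exit at EVERY large β.  Here the «for all large β» of `E` is discharged by topology (PROVED), the
residual per-coupling content is filed in subsequence form (K1) and the inter-coupling content as a no-criticality
statement (K2).  Census C22/B15 (no universal threshold / missing bootstrap) are respected: the threshold is R's
model-dependent `exitTol`, and the bootstrap used is the proved R.

RUNGS (PROVED below, group-blind, from `ColdPurityBridge.coldExit_uniform_of_strongCoupling`): `exits_strongCoupling`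
(K1's body at EVERY `0 ≤ β ≤ r_ρ`) and `exitScaleTame_strongCoupling` (K2's conclusion on the whole window `[0, r_ρ]` with
one common scale, unconditionally).  Both rungs sit where `IR` is known (strong coupling); K1/K2 beyond `r_ρ` are open.
CHEAPEST FALSIFIER / INSTRUMENT (ask ym-ir-eng-2): K2 forbids a bulk transition of 4D `SU(2)`/`SU(3)` (fundamental Wilson
action) at any finite `β > β₁`: the specific-heat peak at `β ≈ 2.2–2.3` (`SU(2)`) must SATURATE with volume (`L = 6, 8,
10, 12`), not scale like `L^{α/ν}`; control `U(1)` at `β ≈ 1.01`: peak grows (transition).  A volume-divergent bulk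
specific heat in `SU(N)` fundamental at finite β beyond the strong-coupling window kills K2 as the route to `E` for that
`(G, r)` (K2 would need `β₁` beyond it and K1 must then supply an exit beyond it).
-/

set_option autoImplicit false

noncomputable section

open Filter Topology MeasureTheory
open scoped SchwartzMap
open Literature.MathematicalPhysics.QuantumFieldTheory Literature.MathematicalPhysics.QuantumLattice
open Literature.MathematicalPhysics.QuantumFieldTheory.Balaban1983to89.Missing (strongCouplingRadius
  strongCouplingRadius_pos)
open Summit.QuantumFields.YangMills.Cruxes.IR.ColdPressurePincer
open Summit.QuantumFields.YangMills.Cruxes.IR.ColdPurityBridge (coldDefect coldPressureAt_of_exit_recursion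
  coldExit_uniform_of_strongCoupling)
open Summit.QuantumFields.YangMills.Cruxes.IR.AspectBootstrap (coldDefect_sq_le_two_pow)
open Summit.QuantumFields.YangMills.Theorems.DoublingDefect (coldDefect_nonneg defect_decay_of_recursion)

namespace Summit.QuantumFields.YangMills.Cruxes.IR.CouplingClopen

/-! ## §1 The per-coupling predicate «β exits» (explicit threshold of the proved recursion R) -/

/-- The exit tolerance of the PROVED sharp recursion: `1/(16·max(2²⁰, 2)) = 2⁻²⁴` (rev 2: the sharp constant of
`AspectBootstrap.coldDefect_sq_le_two_pow`, shared with lines `basin-transfer` ∕ `fss-handover`; rev 1 used `squaringConst`;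
`ColdPurityBridge.coldPressureAt_of_exit_recursion` with `C = 2²⁰`). -/
def exitTol : ℝ := 1 / (16 * max (2 ^ 20 : ℝ) 2)

/-- `exitTol = 2⁻²⁴` (the sharp basin threshold `ε⋆` of `AspectBootstrap.coldDefect_sq_le_two_pow`, shared with lines
`basin-transfer` ∕ `fss-handover` ∕ `thermal-ratchet`). -/
theorem exitTol_eq : exitTol = 1 / 2 ^ 24 := by
  rw [exitTol, max_eq_left (by norm_num : (2 : ℝ) ≤ 2 ^ 20)]; norm_num

/-- `0 < 2²⁰` (the sharp squaring constant is positive). -/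
theorem two_pow_twenty_pos : (0 : ℝ) < 2 ^ 20 := by norm_num

/-- `exitTol > 0`. -/
theorem exitTol_pos : 0 < exitTol := by
  unfold exitTol
  have : 0 < max (2 ^ 20 : ℝ) 2 := lt_max_of_lt_right (by norm_num)
  positivity

section Defs

variable {G : Type} [Group G] [TopologicalSpace G] [IsTopologicalGroup G] [CompactSpace G]
  [MeasurableSpace G] [BorelSpace G]

/-- **«coupling `β` exits»**: some cold torus `L³ × ⌊L/4⌋`, `L ≥ 8`, is `exitTol`-pure at coupling `β`.  By the proved
R and the tree seam this already gives `ColdPressureAt ρ β L` (`onsetSC_of_exits`); one instance is ONE inequality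
between two finite-dimensional Haar integrals. -/
def Exits {N : ℕ} (ρ : G →* Matrix (Fin N) (Fin N) ℂ) (β : ℝ) : Prop :=
  ∃ L : ℕ, 8 ≤ L ∧ coldDefect ρ β L ≤ exitTol

end Defs

/-! ## §2 The stub statements -/

/-- **(K1) `ExitsUnboundedSC` — exiting couplings are unbounded (crux; the Yang–Mills content in subsequence form).**
For compact simple simply-connected `G` and every `r`: for every `β₁` some coupling `β ≥ β₁` exits.  `E` restricted to
an arbitrary unbounded set of couplings; per instance a single certifiable inequality; no units, no uniformity.
Why it might fail: a massless / deconfined phase `[β_c, ∞)` of 4D non-abelian lattice Yang–Mills (then nothing exits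
beyond `β_c`); it FAILS for `U(1)₄` (Guth / Fröhlich–Spencer Coulomb phase) and for `π₁(G) ≠ 1` ('t Hooft light fluxes),
so a proof must use non-abelianness and `π₁ = 1`.
Sources: Luscher1977; OsterwalderSeilerAnnPhys1978 §3; Guth1980; FrohlichSpencer1982; tHooft1979;
`Literature.Barriers.QuantumFields.AbelianDeconfinementD4`; census B2/B7. -/
def ExitsUnboundedSC : Prop :=
  ∀ (G : Type) [Group G] [TopologicalSpace G] [IsTopologicalGroup G] [CompactSpace G],
    IsCompactSimpleLieGroup G → SimplyConnectedSpace G →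
    letI : MeasurableSpace G := borel G
    haveI : BorelSpace G := ⟨rfl⟩
    ∀ r : LatticeRep G, ∀ β₁ : ℝ, ∃ β : ℝ, β₁ ≤ β ∧ Exits r.ρ β

/-- **(K1♭, rev 6–7) `ExitsUnboundedAt θ` — exiting couplings are unbounded AT TOLERANCE `θ`** (the registered K1 is `θ = 1/24` since rev 8 — the top of the LANDED abstract ladder `1/24 → 2⁻⁶ → 2⁻⁸ → 2⁻⁹ → 2⁻²⁴` (p604479) `2⁻⁶ → 2⁻⁸ → 2⁻⁹ → 2⁻²⁴`).
For compact simple simply-connected `G` and every `r`: for every `β₁` some coupling `β ≥ β₁` has ONE cold `4:1` torus of side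
`L ≥ 8` with purity defect `δᶜ_β(L) ≤ θ`.  At `θ = exitTol = 2⁻²⁴` this is `ExitsUnboundedSC` (`exitsUnboundedAt_exitTol_iff`); for every
`θ ≤ 1/24` it IMPLIES `ExitsUnboundedSC` at the SAME couplings by ideator idea-9's LANDED group-free ladder
`BasinRung.abstractBasin_24_epsStar : AbstractBasin (1/24) 2⁻²⁴` (p604479 ∘ p603750 ∘ p603051; transport `exitsUnboundedSC_of_basin` parametric in the rung)
— the basin transport changes the scale, never the coupling, so it commutes with «cofinally in β».  Seed of record per instance: ONE inequality
`Z_β(L³×2m) ≥ (23/24)·Z_β(L³×m)²` (≈ 4.2 % purity defect; SU(2) at β_W = 2.4: a box pair ≈ 40³×{10,20}, FINITE-BOX-PURITY.md v1.3 numbers, GUIDANCE).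
Why it might fail / sources: as `ExitsUnboundedSC` (a non-abelian deconfined phase `[β_c, ∞)`; FAILS for `U(1)₄` and for `π₁(G) ≠ 1`). -/
def ExitsUnboundedAt (θ : ℝ) : Prop :=
  ∀ (G : Type) [Group G] [TopologicalSpace G] [IsTopologicalGroup G] [CompactSpace G],
    IsCompactSimpleLieGroup G → SimplyConnectedSpace G →
    letI : MeasurableSpace G := borel G
    haveI : BorelSpace G := ⟨rfl⟩
    ∀ r : LatticeRep G, ∀ β₁ : ℝ, ∃ β : ℝ, β₁ ≤ β ∧ ∃ L : ℕ, 8 ≤ L ∧ coldDefect r.ρ β L ≤ θ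

theorem exitsUnboundedAt_exitTol_iff : ExitsUnboundedAt exitTol ↔ ExitsUnboundedSC := Iff.rfl

theorem exitsUnboundedAt_mono {θ θ' : ℝ} (h : θ ≤ θ') (hK : ExitsUnboundedAt θ) : ExitsUnboundedAt θ' := by
  intro G _ _ _ _ hG hsc
  letI : MeasurableSpace G := borel G
  haveI : BorelSpace G := ⟨rfl⟩
  intro r β₁
  obtain ⟨β, hβ, L, hL, hδ⟩ := hK G hG hsc r β₁
  exact ⟨β, hβ, L, hL, hδ.trans h⟩

section BasinTransport

variable {G : Type} [Group G] [TopologicalSpace G] [IsTopologicalGroup G] [CompactSpace G]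
  [MeasurableSpace G] [BorelSpace G]

/-- **Per-coupling basin transport, parametric in the abstract rung:** if `AbstractBasin θ ε⋆` holds (group-free; LANDED for `θ = 1/24` by
idea-9's `BasinRung.abstractBasin_24_epsStar`, p604479 ∘ p603750 ∘ p603051), then at `β ≥ 0` a `θ`-pure cold torus of side `≥ 8` forces an
`exitTol = 2⁻²⁴`-pure one of (another) side `≥ 8` — Wilson's theory is an axis-symmetric trace-positive family with volume bounds
(`AspectBootstrap.axisSymmetric ∕ tracePositive ∕ volumeBounds`, `coldDefect_eq_boxDefect`).  The transport moves the SCALE, never the COUPLING. -/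
theorem exits_of_exitAt (r : LatticeRep G) {θ : ℝ} (hA : BasinRung.AbstractBasin θ BasinRung.epsStar) {β : ℝ} (hβ0 : 0 ≤ β)
    {L : ℕ} (hL : 8 ≤ L) (h : coldDefect r.ρ β L ≤ θ) : Exits r.ρ β := by
  rw [AspectBootstrap.coldDefect_eq_boxDefect] at h
  obtain ⟨L', hL', h'⟩ := hA _ (AspectBootstrap.axisSymmetric r β)
    (AspectBootstrap.tracePositive r hβ0) (AspectBootstrap.volumeBounds r hβ0) L hL h
  refine ⟨L', hL', ?_⟩
  rw [AspectBootstrap.coldDefect_eq_boxDefect, exitTol_eq, ← BasinRung.epsStar_eq]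
  exact h'

end BasinTransport

/-- **K1♭(θ) ⇒ K1 whenever the abstract basin reaches `θ` (PROVED, parametric):** plug any landed `AbstractBasin θ ε⋆`. -/
theorem exitsUnboundedSC_of_basin {θ : ℝ} (hA : BasinRung.AbstractBasin θ BasinRung.epsStar) (hK : ExitsUnboundedAt θ) :
    ExitsUnboundedSC := by
  intro G _ _ _ _ hG hsc
  letI : MeasurableSpace G := borel G
  haveI : BorelSpace G := ⟨rfl⟩
  intro r β₁
  obtain ⟨β, hβ, L, hL, hδ⟩ := hK G hG hsc r (max β₁ 0)
  exact ⟨β, le_trans (le_max_left _ _) hβ, exits_of_exitAt r hA (le_trans (le_max_right _ _) hβ) hL hδ⟩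

/-- **K1♭(θ) ⇒ K1 for every `θ ≤ 1/24`** (the abstract ladder of record `1/24 → 2⁻⁶ → 2⁻⁸ → 2⁻⁹ → 2⁻²⁴`, idea-9 ∕ idea-13, all LANDED; top rung p604479). -/
theorem exitsUnboundedSC_of_at {θ : ℝ} (hθ : θ ≤ 1 / 24) (hK : ExitsUnboundedAt θ) : ExitsUnboundedSC :=
  exitsUnboundedSC_of_basin BasinRung.abstractBasin_24_epsStar (exitsUnboundedAt_mono hθ hK)


/-- **(K2) `ExitScaleTameSC` — no divergence of the purity length at finite coupling beyond `β₁` (crux; structural).**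
For compact simple simply-connected `G` and every `r` there is `β₁` such that on every compact coupling range
`[u, v] ⊂ (β₁, ∞)` ONE scale `P ≥ 8` serves all exiting couplings: `Exits r.ρ β → δᶜ_β(P) ≤ exitTol/2`.  Given R this is
exactly local boundedness of `L_exit` where finite, i.e. no coupling `β* > β₁` is a limit of exiting couplings with
diverging purity length: no bulk phase transition beyond `β₁` seen from the massive side.  Vacuously true on ranges
where nothing exits (so TRUE for `U(1)₄` with `β₁ = β_c`, and for `π₁ ≠ 1`).
Why it might fail: infinitely many bulk transitions of the `(G, r)` Wilson action accumulating at `β = ∞` (for exotic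
high representations `r` the Bhanot–Creutz-type first-order lines are crossed at `r`-dependent couplings — finitely
often is the bet); a finite-coupling critical point beyond every `β₁` would contradict asymptotic scaling.
Sources: Creutz1980 (PRD 21, 2308: SU(2) crossover, no bulk transition); BhanotCreutz1981 (PRD 24, 3212);
LuciniTeperWenger2005 (hep-lat/0502003, bulk transition SU(N ≥ 4)); KoteckyShlosman1982 / census A10–A11
(first-order gauge transitions exist: why `β₁` is needed); BorgsKotecky1990 (finite-size rounding `V ∼ 1/Δf`). -/
def ExitScaleTameSC : Prop :=
  ∀ (G : Type) [Group G] [TopologicalSpace G] [IsTopologicalGroup G] [CompactSpace G],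
    IsCompactSimpleLieGroup G → SimplyConnectedSpace G →
    letI : MeasurableSpace G := borel G
    haveI : BorelSpace G := ⟨rfl⟩
    ∀ r : LatticeRep G, ∃ β₁ : ℝ, ∀ u v : ℝ, β₁ < u → u ≤ v →
      ∃ P : ℕ, 8 ≤ P ∧ ∀ β : ℝ, u ≤ β → β ≤ v → Exits r.ρ β → coldDefect r.ρ β P ≤ exitTol / 2

/-- **(S) `DefectContinuous` — the purity defect of a fixed torus is continuous in the coupling (support; PROVED below as `defectContinuous_holds`,
group-blind).**  `β ↦ δᶜ_β(L) = 1 − Z_β(L³×2⌊L/4⌋)/Z_β(L³×⌊L/4⌋)²` is continuous: each `Z_β` is a Haar integral of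
`exp(−β·S)` with `S` continuous and bounded on a compact group power (dominated convergence), and `Z_β > 0`
(`wilsonFinTorusPartition_pos`).  [folklore] -/
def DefectContinuous : Prop :=
  ∀ (G : Type) [Group G] [TopologicalSpace G] [IsTopologicalGroup G] [CompactSpace G] [MeasurableSpace G]
    [BorelSpace G] (r : LatticeRep G) (L : ℕ), Continuous fun β : ℝ => coldDefect r.ρ β L

/-! ## §3 Registered stubs (sorries live ONLY here) -/

/-- stub **K1** (crux, rank 2), rev 7 re-based on idea-9's landed ladder (rev 8: top rung 1/24, p604479): `ExitsUnboundedAt (1/24)` — the seed at tolerance `1/24 ≈ 4.2 %`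
cofinally in `β` (⇒ `ExitsUnboundedSC` by `exitsUnboundedSC_of_at`). OPEN (body PROVED on `[0, r_ρ]`: `exitsAt_strongCoupling`). -/
theorem stub_exitsUnbounded : ExitsUnboundedAt (1 / 24) := by
  sorry

/-- stub **K2** (crux, rank 3 — structural): `ExitScaleTameSC`. OPEN (conclusion PROVED on `[0, r_ρ]`:
`exitScaleTame_strongCoupling`). -/
theorem stub_exitScaleTame : ExitScaleTameSC := by
  sorry

/-- **S is PROVED (rev 3) and LANDED (rev 4, p602299 `CouplingAxis.continuous_coldDefect`): the purity defect of a fixed torus is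
continuous in the coupling.**  Each `β ↦ Z_β(L,L,L,m)` is the real restriction of the ENTIRE complex partition function
(`differentiable_wilsonFinTorusPartitionC`, `wilsonFinTorusPartitionC_ofReal`), hence continuous, and `Z_β > 0`
(`wilsonFinTorusPartition_pos`). -/
theorem defectContinuous_holds : DefectContinuous := fun G _ _ _ _ _ _ r L =>
  -- LANDED in the tree (p602299, `Theorems/BalabanLadderIRColdDefectContinuous.lean`): real restriction of the entire complex Z.
  Summit.QuantumFields.YangMills.Cruxes.IR.CouplingAxis.continuous_coldDefect r L

/-- stub **X** (token of record, BY NAME): `ColdPressurePincer.AFToColdPressure` — the asymptotic-freedom pin shared with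
lines 9/10 (`af-pincer`, `doubling-bridge`). -/
theorem stub_afPin : AFToColdPressure := by
  sorry

/-- stub **N** (RESIDUAL of record, BY NAME): `ColdPressurePincer.IRnsc`. -/
theorem stub_irnsc : IRnsc := by
  sorry

/-! ## §4 The composition, PROVED: K1 ∧ K2 (∧ S, proved) ⇒ every coupling beyond `β₁` exits (clopen) ⇒ onset ⇒ `IR` -/

/-- «every coupling beyond some `β₁` exits» (the per-coupling form of the seed `E`, simply-connected half). -/
def AllExitSC : Prop :=
  ∀ (G : Type) [Group G] [TopologicalSpace G] [IsTopologicalGroup G] [CompactSpace G],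
    IsCompactSimpleLieGroup G → SimplyConnectedSpace G →
    letI : MeasurableSpace G := borel G
    haveI : BorelSpace G := ⟨rfl⟩
    ∀ r : LatticeRep G, ∃ β₁ : ℝ, ∀ β : ℝ, β₁ < β → Exits r.ρ β

/-- **The clopen propagation (REAL proof).**  K1 ∧ K2 ∧ S ⇒ every coupling beyond K2's `β₁` exits: on `[β, b₀]`
(`b₀ ≥ β + 1` exiting, from K1) the exiting couplings form a set that is closed (`δᶜ(P) ≤ exitTol/2`, continuity) and
open (`δᶜ(P) < exitTol`), and `[β, b₀]` is preconnected. -/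
theorem allExit_of_clopen (hK1 : ExitsUnboundedSC) (hK2 : ExitScaleTameSC) (hS : DefectContinuous) : AllExitSC := by
  -- rev 5: the topology is LANDED (p602902 `CouplingAxis.allExit_of_clopen`, per representation, tolerances η < ε);
  -- `hS` is kept in the signature for the record (S is the landed `continuous_coldDefect`, used inside the tree theorem).
  intro G _ _ _ _ hG hsc
  letI : MeasurableSpace G := borel G
  haveI : BorelSpace G := ⟨rfl⟩
  intro r
  obtain ⟨β₁, hT⟩ := hK2 G hG hsc r
  exact ⟨β₁, CouplingAxis.allExit_of_clopen r (ε := exitTol) (η := exitTol / 2) (by linarith [exitTol_pos])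
    (hK1 G hG hsc r) hT⟩

/-! ### §4b The converse (crit-3 P3): AllExit ⇒ K1 ∧ K2, so the split is EXACT in the kernel

(rev 5: both directions now cite the LANDED per-representation theorems of `Theorems/BalabanLadderIRCouplingAxisTransport.lean`, p602902.)
`exitScaleTame_of_allExit` = compactness of `[u, v]` + continuity S + decay (`CouplingAxis.decay_of_exit`): finitely many exit scales serve neighbourhoods covering `[u, v]`, and one
common large scale `P` purifies every coupling of the range to `exitTol/2`. -/

section Decay

variable {G : Type} [Group G] [TopologicalSpace G] [IsTopologicalGroup G] [CompactSpace G]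
  [MeasurableSpace G] [BorelSpace G]

/-- **An exit is eventually pure at every tolerance** — LANDED (p602902 `CouplingAxis.eventuallyPure_of_exit`, sharp tolerance
`2⁻²⁴ = exitTol`); restated here over `exitTol`. -/
theorem eventuallyPure_of_exit (r : LatticeRep G) {β : ℝ} (hβ0 : 0 ≤ β) {L : ℕ} (hL8 : 8 ≤ L)
    (hex : coldDefect r.ρ β L ≤ exitTol) {ε : ℝ} (hε : 0 < ε) (L₁ : ℕ) :
    ∃ P : ℕ, L₁ ≤ P ∧ 8 ≤ P ∧ coldDefect r.ρ β P ≤ ε :=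
  CouplingAxis.eventuallyPure_of_exit r hβ0 hL8 (by rw [← exitTol_eq]; exact hex) hε L₁

end Decay

/-- **AllExit ⇒ K1** (trivial: every coupling beyond `β₁` exits, so exiting couplings are unbounded). -/
theorem exitsUnbounded_of_allExit (h : AllExitSC) : ExitsUnboundedSC := by
  intro G _ _ _ _ hG hsc
  letI : MeasurableSpace G := borel G
  haveI : BorelSpace G := ⟨rfl⟩
  intro r β₀
  obtain ⟨β₁, hex⟩ := h G hG hsc r
  exact ⟨max β₀ β₁ + 1, by linarith [le_max_left β₀ β₁], hex _ (by linarith [le_max_right β₀ β₁])⟩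

/-- **AllExit ⇒ K2 (PROVED; crit-3 P3 — the split `E ⇔ K1 ∧ K2` is EXACT in the kernel).**  Beyond `max β₁ 0` every
coupling exits; by `eventuallyPure_of_exit` each `b ∈ [u, v]` has a scale `Q_b ≥ 8` with `δᶜ_b(Q_b) < exitTol` STRICTLY,
hence (continuity S, PROVED) an open neighbourhood `U_b` of couplings exiting at scale `Q_b`; `[u, v]` is compact, so
finitely many `U_{b_i}` cover it; `decay_of_exit` from scale `Q_{b_i}` bounds `δᶜ_c(P) ≤ C'⁻¹ e^{−(P+1)/Q_{b_i}}` on `U_{b_i}`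
for all `P ≥ 2 Q_{b_i}`, and ONE `P` large for all finitely many `i` gives `δᶜ_c(P) ≤ exitTol/2` for every `c ∈ [u, v]`. -/
theorem exitScaleTame_of_allExit (h : AllExitSC) : ExitScaleTameSC := by
  -- rev 5: the compactness argument is LANDED (p602902 `CouplingAxis.exitScaleTame_of_allExit`, any target tolerance η > 0).
  intro G _ _ _ _ hG hsc
  letI : MeasurableSpace G := borel G
  haveI : BorelSpace G := ⟨rfl⟩
  intro r
  obtain ⟨β₁, hex⟩ := h G hG hsc r
  refine ⟨max β₁ 0, fun u v hu huv => ?_⟩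
  have hAll : ∀ β : ℝ, max β₁ 0 < β → ∃ L : ℕ, 8 ≤ L ∧ coldDefect r.ρ β L ≤ 1 / 2 ^ 24 := fun β hβ => by
    rw [← exitTol_eq]; exact hex β (lt_of_le_of_lt (le_max_left _ _) hβ)
  obtain ⟨P, hP8, hP⟩ := CouplingAxis.exitScaleTame_of_allExit r (le_max_right β₁ 0) hAll (half_pos exitTol_pos)
    u v hu huv
  exact ⟨P, hP8, fun β hβu hβv _ => hP β hβu hβv⟩

/-- **The split is EXACT (kernel): `AllExitSC ↔ K1 ∧ K2`** (S discharged by `defectContinuous_holds`, R by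
`coldDefect_sq_le_two_pow`). -/
theorem allExit_iff : AllExitSC ↔ ExitsUnboundedSC ∧ ExitScaleTameSC :=
  ⟨fun h => ⟨exitsUnbounded_of_allExit h, exitScaleTame_of_allExit h⟩,
    fun h => allExit_of_clopen h.1 h.2 defectContinuous_holds⟩

/-- «all exit» is the landed single-tolerance seed `BasinRung.ColdExitAt ε⋆` (idea-9, p603051 ∕ its parent rung file). -/
theorem coldExitAt_of_allExit (h : AllExitSC) : BasinRung.ColdExitAt BasinRung.epsStar := by
  intro G _ _ _ _ hG hsc
  letI : MeasurableSpace G := borel G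
  haveI : BorelSpace G := ⟨rfl⟩
  intro r
  obtain ⟨β₁, hex⟩ := h G hG hsc r
  refine ⟨β₁ + 1, fun β hβ => ?_⟩
  obtain ⟨L, hL8, hδ⟩ := hex β (by linarith)
  exact ⟨L, hL8, by rw [BasinRung.epsStar_eq, ← exitTol_eq]; exact hδ⟩

/-- **Every exit is a cold-pressure length** — now BY NAME: `BasinRung.coldPressureOnsetSC_of_exitAt` (landed; the sharp recursion
`coldDefect_sq_le_two_pow` fed to the seam `coldPressureAt_of_exit_recursion`). -/
theorem onsetSC_of_allExit (h : AllExitSC) : ColdPressureOnsetSC :=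
  BasinRung.coldPressureOnsetSC_of_exitAt (coldExitAt_of_allExit h)

/-- **The line concludes the crux `IR` BY NAME** from K1♭ (`1/24`), K2 and the tokens X, N: K1♭ ⇒ K1 (landed basin ladder) ; K1 ∧ K2 ∧ S ⇒ all
exit (clopen, landed) ⇒ `ColdExitAt ε⋆` ⇒ `IR` (`BasinRung.IR_of_exitAt`, landed pincer of record). -/
theorem IR_of (hK1 : ExitsUnboundedAt (1 / 24)) (hK2 : ExitScaleTameSC) (hX : AFToColdPressure)
    (hN : IRnsc) : Summit.QuantumFields.YangMills.Theses.BalabanLadder.IR :=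
  BasinRung.IR_of_exitAt
    (coldExitAt_of_allExit (allExit_of_clopen (exitsUnboundedSC_of_at le_rfl hK1) hK2 defectContinuous_holds)) hX hN

/-- **Proof-of-item shape**: the crux from the four registered stubs (S is proved, rev 3; K1 at `1/24`, rev 8). -/
theorem IR_of_stubs : Summit.QuantumFields.YangMills.Theses.BalabanLadder.IR :=
  IR_of stub_exitsUnbounded stub_exitScaleTame stub_afPin stub_irnsc

/-! ## §5 Rungs (PROVED, group-blind): K1's body and K2's conclusion on the strong-coupling window `[0, r_ρ]` -/

section Rungs

variable {G : Type} [Group G] [TopologicalSpace G] [IsTopologicalGroup G] [CompactSpace G]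
  [MeasurableSpace G] [BorelSpace G]

/-- **RUNG for K2 (PROVED): on the whole strong-coupling window ONE common scale `P = 8k₁` makes EVERY coupling
`exitTol/2`-pure** — K2's conclusion there, unconditionally and uniformly (compact `G`, any `r`; OS78 cluster expansion
via the tree's `coldExit_uniform_of_strongCoupling`). -/
theorem exitScaleTame_strongCoupling (r : LatticeRep G) :
    ∃ P : ℕ, 8 ≤ P ∧ ∀ β : ℝ, 0 ≤ β → β ≤ strongCouplingRadius r.ρ → coldDefect r.ρ β P ≤ exitTol / 2 := by
  obtain ⟨k₁, hk₁, h⟩ := coldExit_uniform_of_strongCoupling r (half_pos exitTol_pos)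
  exact ⟨8 * k₁, by omega, fun β hβ0 hβ => h β hβ0 hβ k₁ le_rfl⟩

/-- **RUNG for K1 (PROVED): every coupling of the strong-coupling window exits** (compact `G`, any `r`). -/
theorem exits_strongCoupling (r : LatticeRep G) {β : ℝ} (hβ0 : 0 ≤ β) (hβ : β ≤ strongCouplingRadius r.ρ) :
    Exits r.ρ β := by
  obtain ⟨P, hP8, h⟩ := exitScaleTame_strongCoupling r
  refine ⟨P, hP8, (h β hβ0 hβ).trans ?_⟩
  linarith [exitTol_pos]

/-- **RUNG for K1♭ (PROVED):** every coupling of the strong-coupling window exits at tolerance `1/24` (indeed at `2⁻²⁵`). -/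
theorem exitsAt_strongCoupling (r : LatticeRep G) {β : ℝ} (hβ0 : 0 ≤ β) (hβ : β ≤ strongCouplingRadius r.ρ) :
    ∃ L : ℕ, 8 ≤ L ∧ coldDefect r.ρ β L ≤ 1 / 24 := by
  obtain ⟨L, hL8, h⟩ := exits_strongCoupling r hβ0 hβ
  exact ⟨L, hL8, h.trans (by rw [exitTol_eq]; norm_num)⟩

end Rungs

end Summit.QuantumFields.YangMills.Cruxes.IR.CouplingClopen

end
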